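import Summits.Ventures.CertifiedArithmetic.LowPrec.RoundToOddDouble

/-!
# Round to odd beyond the range: `RN_φ ∘ RO_ψ = RN_φ` on ALL of `ℚ` (saturation included)

HONEST FRAMING (venture CertifiedArithmetic / cell `pub-lowprec`): certified error envelopes and
provably optimal rounding/accumulation schemes for low-precision formats under stated cost models;
every table by two implementations; no hardware or vendor claims.

`RoundToOddDouble.toRat_roundNE_roundOdd` asks `|s| ≤ maxRat ψ` (no overflow of the wide
intermediate). Under the cell's SATURATING conventions the hypothesis is unnecessary: beyond
`maxRat ψ` both directed roundings of `ψ` — hence `roundOdd ψ` — return `±maxRat ψ`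
(`toRat_roundDown_of_maxRat_le`, `toRat_roundUp_of_maxRat_lt`, `toRat_roundOddPos_of_maxRat_le`),
which `φ` saturates to `±maxRat φ` exactly as it saturates `s` itself. Hence
`toRat_roundNE_roundOdd_all`: for `m_φ + 2 ≤ m_ψ`, `bias_φ ≤ bias_ψ`, `maxRat φ ≤ maxRat ψ` and
EVERY rational `s`, `fl_φ(RO_ψ(s)) = fl_φ(s)`; verdicts without any hypothesis on `s`
(`E4M3_via_BFloat16_roundOdd_all`, `BFloat16_via_Binary32_roundOdd_all`, …).
[cite: BoldoMelquiond2008, Thm 3] (there for unbounded exponents; the saturating clause is this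
development's).
-/

namespace Literature.ComputerArithmetic.FloatingPoint

namespace Format

variable {φ : Format}

/-- Beyond the top the round-down grid saturates: `rdGrid r = maxScaled` for `r ≥ maxScaled`
(`maxScaled` is a multiple of the top spacing lying below `r`). [folklore] -/
theorem rdGrid_eq_maxScaled_of_le {r : ℚ} (h : (φ.maxScaled : ℚ) ≤ r) : φ.rdGrid r = φ.maxScaled := by
  unfold rdGrid
  apply min_eq_right
  set sh := φ.shift ⌊r⌋.toNat with hsh_def
  have hdvd : 2 ^ sh ∣ φ.maxScaled := by
    have hsh : sh ≤ φ.emaxCode - 1 := shift_le _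
    rcases Nat.eq_zero_or_pos φ.emaxCode with h0 | hpos
    · have : sh = 0 := by omega
      rw [this, pow_zero]; exact one_dvd _
    · unfold maxScaled scaled
      rw [if_neg (by omega)]
      exact Dvd.dvd.mul_left (Nat.pow_dvd_pow 2 hsh) _
  obtain ⟨M, hM⟩ := hdvd
  have hc : (0 : ℚ) < 2 ^ sh := by positivity
  have hMle : (M : ℤ) ≤ ⌊r / 2 ^ sh⌋ := by
    rw [Int.le_floor, le_div_iff₀ hc]
    calc ((M : ℤ) : ℚ) * 2 ^ sh = φ.maxScaled := by rw [hM]; push_cast; ring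
      _ ≤ r := h
  have hMnat : M ≤ (⌊r / 2 ^ sh⌋).toNat := by omega
  calc φ.maxScaled = M * 2 ^ sh := by rw [hM]; ring
    _ ≤ (⌊r / 2 ^ sh⌋).toNat * 2 ^ sh := Nat.mul_le_mul_right _ hMnat

/-- Beyond the top the round-up grid saturates (by definition). [folklore] -/
theorem ruGrid_eq_maxScaled_of_lt {r : ℚ} (h : (φ.maxScaled : ℚ) < r) : φ.ruGrid r = φ.maxScaled := by
  unfold ruGrid; rw [if_neg (not_le.mpr h)]

end Format

namespace MiniFloat

open Format

variable {φ ψ : Format}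

/-- `maxRat ≥ 0`. [folklore] -/
theorem maxRat_nonneg (φ : Format) : 0 ≤ φ.maxRat :=
  mul_nonneg (Nat.cast_nonneg _) φ.quantum_pos.le

/-- SATURATION of round-down above the top: `RD(s) = maxRat` for `s ≥ maxRat`. [cite: RouhaniEtAl2023MX, §3] -/
theorem toRat_roundDown_of_maxRat_le {s : ℚ} (h : φ.maxRat ≤ s) : (roundDown φ s).toRat = φ.maxRat := by
  have hq := φ.quantum_pos
  have hs0 : 0 ≤ s := le_trans (maxRat_nonneg φ) h
  have hr : (φ.maxScaled : ℚ) ≤ |s| / φ.quantum := by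
    rw [abs_of_nonneg hs0, le_div_iff₀ hq]; exact h
  rw [toRat_roundDown, if_neg (not_lt.mpr hs0), rdGrid_eq_maxScaled_of_le hr]; rfl

/-- SATURATION of round-up above the top: `RU(s) = maxRat` for `s > maxRat`. [cite: RouhaniEtAl2023MX, §3] -/
theorem toRat_roundUp_of_maxRat_lt {s : ℚ} (h : φ.maxRat < s) : (roundUp φ s).toRat = φ.maxRat := by
  have hq := φ.quantum_pos
  have hs0 : 0 ≤ s := le_trans (maxRat_nonneg φ) h.le
  have hr : (φ.maxScaled : ℚ) < |s| / φ.quantum := by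
    rw [abs_of_nonneg hs0, lt_div_iff₀ hq]; exact h
  rw [toRat_roundUp, if_neg (not_lt.mpr hs0), ruGrid_eq_maxScaled_of_lt hr]; rfl

/-- SATURATION of round to odd: `RO(s) = maxRat` for `s ≥ maxRat`. [folklore] -/
theorem toRat_roundOddPos_of_maxRat_le {s : ℚ} (h : φ.maxRat ≤ s) :
    (roundOddPos φ s).toRat = φ.maxRat := by
  have hrd := toRat_roundDown_of_maxRat_le h
  unfold roundOddPos
  by_cases hex : (roundDown φ s).toRat = s
  · rw [if_pos hex]; exact hrd
  · rw [if_neg hex]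
    have hlt : φ.maxRat < s := lt_of_le_of_ne h (fun heq => hex (by rw [hrd, heq]))
    split
    · exact toRat_roundUp_of_maxRat_lt hlt
    · exact hrd

/-- **`RN_φ ∘ RO_ψ = RN_φ` ON ALL OF `ℚ`**: for formats `φ`, `ψ` with `m_φ + 2 ≤ m_ψ`,
`bias_φ ≤ bias_ψ`, `maxRat φ ≤ maxRat ψ` and EVERY rational `s` (overflow of the wide intermediate
included: both formats saturate), `fl_φ(RO_ψ(s)) = fl_φ(s)` as values.
[cite: BoldoMelquiond2008, Thm 3] -/
theorem toRat_roundNE_roundOdd_all (hm : φ.manBits + 2 ≤ ψ.manBits) (hb : φ.bias ≤ ψ.bias)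
    (hmax : φ.maxRat ≤ ψ.maxRat) (s : ℚ) :
    (roundNE φ (roundOdd ψ s).toRat).toRat = (roundNE φ s).toRat := by
  by_cases hs : |s| ≤ ψ.maxRat
  · exact toRat_roundNE_roundOdd hm hb hmax hs
  · have hs' : ψ.maxRat < |s| := not_le.mp hs
    -- the positive case, then symmetry
    have key : ∀ t : ℚ, ψ.maxRat < t →
        (roundNE φ (roundOdd ψ t).toRat).toRat = (roundNE φ t).toRat := by
      intro t ht
      have ht0 : 0 ≤ t := le_trans (maxRat_nonneg ψ) ht.le
      rw [roundOdd_of_nonneg ht0, toRat_roundOddPos_of_maxRat_le ht.le,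
        toRat_roundNE_of_maxRat_le_pos hmax, toRat_roundNE_of_maxRat_le_pos (by linarith)]
    rcases le_or_gt 0 s with h0 | h0
    · rw [abs_of_nonneg h0] at hs'; exact key s hs'
    · rw [abs_of_neg h0] at hs'
      have h := key (-s) hs'
      rw [toRat_roundOdd_neg, toRat_roundNE_neg, toRat_roundNE_neg, neg_inj] at h
      exact h

/-! ### Verdicts without any hypothesis on the input -/

/-- E4M3 via bfloat16 with round to odd: innocuous for EVERY rational input. -/
theorem E4M3_via_BFloat16_roundOdd_all (s : ℚ) :
    (roundNE E4M3 (roundOdd BFloat16 s).toRat).toRat = (roundNE E4M3 s).toRat :=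
  toRat_roundNE_roundOdd_all (by decide) (by decide) (by decide +kernel) s

/-- E5M2 via bfloat16 with round to odd: innocuous for every rational input. -/
theorem E5M2_via_BFloat16_roundOdd_all (s : ℚ) :
    (roundNE E5M2 (roundOdd BFloat16 s).toRat).toRat = (roundNE E5M2 s).toRat :=
  toRat_roundNE_roundOdd_all (by decide) (by decide) (by decide +kernel) s

/-- E4M3 / E5M2 via binary16 with round to odd: innocuous for every rational input. -/
theorem FP8_via_Binary16_roundOdd_all (s : ℚ) :
    (roundNE E4M3 (roundOdd Binary16 s).toRat).toRat = (roundNE E4M3 s).toRat ∧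
      (roundNE E5M2 (roundOdd Binary16 s).toRat).toRat = (roundNE E5M2 s).toRat :=
  ⟨toRat_roundNE_roundOdd_all (by decide) (by decide) (by decide +kernel) s,
    toRat_roundNE_roundOdd_all (by decide) (by decide) (by decide +kernel) s⟩

/-- bfloat16 and binary16 via binary32 with round to odd: innocuous for every rational input. -/
theorem Half_via_Binary32_roundOdd_all (s : ℚ) :
    (roundNE BFloat16 (roundOdd Binary32 s).toRat).toRat = (roundNE BFloat16 s).toRat ∧
      (roundNE Binary16 (roundOdd Binary32 s).toRat).toRat = (roundNE Binary16 s).toRat :=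
  ⟨toRat_roundNE_roundOdd_all (by decide) (by decide) (by decide +kernel) s,
    toRat_roundNE_roundOdd_all (by decide) (by decide) (by decide +kernel) s⟩

/-- Kernel replay of the saturating clause: `RO_bf16(10^40)` saturates to `maxRat bf16`, which E4M3
saturates to `448` — exactly as E4M3 saturates `10^40` itself. -/
example : (roundNE E4M3 (roundOdd BFloat16 ((10 : ℚ) ^ 40)).toRat).toRat = 448 ∧
    (roundNE E4M3 ((10 : ℚ) ^ 40)).toRat = 448 := by
  constructor <;> decide +kernel

end MiniFloat

end Literature.ComputerArithmetic.FloatingPoint
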